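import Literature.NumberTheory.EllipticCurves.LambdaAdicSelmerDataSaturatedKodairaNeronProofs
import Literature.NumberTheory.EllipticCurves.ZpExtensionEisensteinTwistCoresOrdinary
import Literature.NumberTheory.EllipticCurves.LocalPointsOrdinaryKummerCongruenceProofs
import Literature.NumberTheory.EllipticCurves.LocalPointsOrdinaryKernelDivisibleProofs
import Literature.NumberTheory.EllipticCurves.ZpExtensionEisensteinOrdinaryFiltration
import Literature.NumberTheory.EllipticCurves.ZpExtensionEisensteinSelmerLocalCriterion
import HarnessLib

/-!
# Clause `(p)` of Howard's Selmer criterion for `𝔖_p(K_∞)` at the places `v ∣ p` of good ordinary reduction, and the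
# containment `f(𝔖_p(K_∞)) ⊆ H¹_{F_𝔮}(K, T_𝔮)` of the compact control map (Howard 2004, Lemma 2.2.7 / Prop. 2.2.8)

Topic `NumberTheory/EllipticCurves`; namespace `WeierstrassCurve.LambdaAdicSelmerData`. THEOREMS ONLY (no definition, no named
fact, no instance, no `sorry`).

Setting (cell `pub/bsd-print-x9`, D1 road of the shared μ-item): `E/K` an elliptic curve over a number field (`V`), `κ` a
`ℤ_p`-extension, `𝔖 = 𝔖_p(K_∞)` Perrin-Riou's compact Selmer module (`D : V.LambdaAdicSelmerData κ γ`), Howard's twisted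
coefficients `T_𝔮/p^k = E[p^k] ⊗ A_{m,k}(ψ)` at `κ⁻ = κ.unitTwist (-1)`, the compact control map
`f = toEisensteinH1Linear : 𝔖 →ₗ[Λ] H¹(K, T_𝔮)` (`LambdaAdicSelmerDataToEisensteinH1Linear`), and Howard's Selmer structure `F_𝔮`
(`ZpExtension.eisensteinSelmerStructure`, with the ordinary datum `V.ordinaryFiltrationAt v t ht` at `v ∣ p`: `Fil_v E[p^k] =
E[p^k] ∩ E₁(K̄_v)`, `ZpExtensionEisensteinOrdinaryFiltration`) whose pinned Selmer module is `EisensteinH1Data.ordinarySelmer`.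
The place-by-place criterion `EisensteinH1Data.mem_ordinarySelmer_of_local` has three clauses: `(ur)` (finite `v ∉ S`, `v ∤ p`;
proved for `f s` in `LambdaAdicSelmerDataUnramified`), `(S)` (`v ∈ S`, `v ∤ p`; proved for `f s` in
`LambdaAdicSelmerDataSaturatedKodairaNeronProofs`) and `(p)`: at `v ∣ p`, `∃ a, ∀ k, p^a • loc_v (proj k h)` lies in the STRICT
ORDINARY core `ker (H¹(K_v, W_k) → H¹(K_v, W_k / Fil_v W_k))`. This file proves `(p)` for `h = f s` at every `v ∣ p` of GOOD
ORDINARY reduction under a uniformity hypothesis on `κ` at `v` — the residue degrees of the layers `K_n` at the primes above `v`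
are bounded (`hres`: `σ^{N₀} ∈ H_{v,n} · I_{K_v}` for all `n`, `σ ∈ Γ_{K_v}`; automatic when `v` ramifies in `K_∞`, e.g. for the
anticyclotomic `ℤ_p`-extension of an imaginary quadratic field) — and assembles the three clauses:

* `proj_conj_cocycle_sub_coboundary_mem_torsionFilAt` — the cocycle-level input of
  `ZpExtension.localization_coresEisenstein_mem_ordinaryCore` (`ZpExtensionEisensteinTwistCoresOrdinary`) for the conjugates of a
  layer class `D.proj n s k ∈ Sel^{(p^k)}(E/K_n)`: by the local Kummer condition at `v` the conjugate cocycle is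
  `τ ↦ τP − P` on `H_{v,n} = Γ_{K_v} ∩ Γ_n` (`CocycleCriteria.resH1Hom_oneCocycleClass_eq_zero_iff`), and by the
  torsion-coboundary congruence (`exists_torsion_sub_coboundary_mem_localKernelOfReduction`,
  `LocalPointsOrdinaryKummerCongruenceProofs`) `p^a` times it is, modulo `Fil_v = E[p^k] ∩ E₁(K̄_v)`, the coboundary of an
  (algebraic, `exists_pointsMapOfEmb_eq_of_nsmul_eq_zero`) `p^k`-torsion point.
* **`nsmul_localization_proj_toEisensteinH1Linear_mem_ordinaryCore`** — clause `(p)` for `h = f s` at a place `v ∣ p` of good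
  ordinary reduction (uniform `a = #T`, `T` the finitely many `E₁`-cosets with reduction in `Ẽ(𝔽_{q_v^{N₀}})`,
  `exists_finset_sub_mem_localKernelOfReduction_of_isArithFrobAt_pow`; `E₁` is `p`-divisible,
  `LocalPointsOrdinaryKernelDivisibleProofs`; Lagrange + Bézout, `AddSubgroup.exists_nsmul_sub_mem_of_finset`). This is
  Greenberg, LNM 1716, §2 Props. 2.2/2.4 (the local Kummer image at `v ∣ p` versus the ordinary condition) in Howard's
  saturated form.
* **`toEisensteinH1Linear_mem_ordinarySelmer`**, **`toEisensteinH1Linear_mem_selmerSubmodule`** — for every `s ∈ 𝔖`, `f s`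
  lies in Howard's `H¹_{F_𝔮}(K, T_𝔮)` (`ordinarySelmer`; equivalently in the `Λ`-submodule `selmerSubmodule`, the `H_m` of the
  μ-item's D1 road) for any finite `S ⊇ badPlaces`, provided every `v ∣ p` is a place of good ordinary reduction with bounded
  residue degrees in `κ`: **the image of the compact control map lies in the Selmer module of `F_𝔮`** (Howard, *Compos. Math.*
  140 (2004), Lemma 2.2.7 and Prop. 2.2.8).

References: B. Howard, *Compos. Math.* 140 (2004), §2.2 (Lemma 2.2.7, Prop. 2.2.8), §3.1 (`H¹_ord`), Def. 3.2.5–3.2.6;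
R. Greenberg, LNM 1716 (1999), §2 (Props. 2.1–2.4); B. Mazur, K. Rubin, *Kolyvagin systems* (2004), Lemma 5.3.13;
J. H. Silverman, *AEC* (2009), VII.2, X.§4. No summit statement is proved here; BSD is not proved by any of this.
-/

noncomputable section

open scoped TensorProduct Topology ContRepresentation Classical NumberField NNReal
open Field CategoryTheory NumberField IsDedekindDomain
open Literature.NumberTheory.GaloisRepresentations Literature.NumberTheory.EllipticCurves
open Literature.NumberTheory.EllipticCurves.ZpExtension (eisensteinLevel)

universe u

namespace WeierstrassCurve.LambdaAdicSelmerData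

variable {K : Type u} [Field K] [NumberField K] {V : WeierstrassCurve K} [V.IsElliptic] {p : ℕ} [hp : Fact p.Prime]
  {κ : ZpExtension K p} {γ : absoluteGaloisGroup K} (D : V.LambdaAdicSelmerData κ γ) {m : ℕ} (hm : 1 ≤ m)

/-- **The conjugates of a layer class are, on `Γ_{K_v} ∩ Γ_n` and up to `p^a`, coboundaries modulo `Fil_v`.** Let
`θ = D.proj n s k = [z] ∈ Sel^{(p^k)}(E/K_n)`, `v` a place of good reduction, `H_v = Γ_{K_v} ∩ Γ_n` (pre-image of `Γ_n` under
`Γ_{K_v} → Γ_K`), and assume (div₁) `E₁(K̄_v)` is `p^k`-divisible and (div_H) `p^a (E(K̄_v)/E₁)^{H_v} ⊆ p^k (E(K̄_v)/E₁)^{H_v}`.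
Then for every `g ∈ Γ_K` there is `y ∈ E[p^k](K̄)` with
`g · (p^a z)(g⁻¹ τ g) − (τ y − y) ∈ Fil_v E[p^k] = E[p^k] ∩ E₁(K̄_v)` for all `τ ∈ H_v` — the hypothesis of
`ZpExtension.localization_coresEisenstein_mem_ordinaryCore` for the cocycle `p^a • z`. (The local Kummer condition of the
conjugate class at `v` gives `P ∈ E(K̄_v)` with `g z(g⁻¹τg) = τP − P`; then `exists_torsion_sub_coboundary_mem_localKernelOfReduction`
and the algebraicity of torsion.) [cite: GreenbergLNM1716, §2 Props. 2.1–2.2 (pp. 70–72)]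
[cite: Howard2004HeegnerKolyvagin, §2.2 Lemma 2.2.7 and §3.1 (H¹_ord)] [cite: SilvermanAEC2009, X.§4 proof of Thm. 4.2(b)] -/
theorem proj_conj_cocycle_sub_coboundary_mem_torsionFilAt {v : HeightOneSpectrum (𝓞 K)}
    (n k a : ℕ) (s : D.S) (g : absoluteGaloisGroup K)
    (z : contOneCocycles (subgroupRep (V.torsionGaloisModule ((p : ℤ) ^ k)).toTopRep (κ.layerSubgroup n)))
    (hz : oneCocycleClass _ z = D.proj n s k)
    (hdiv₁ : ∀ Q ∈ V.localKernelOfReduction v, ∃ Z ∈ V.localKernelOfReduction v, p ^ k • Z = Q)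
    (hdivH : ∀ R : localPoints V (v.adicCompletion K),
      (∀ σ ∈ (κ.layerSubgroup n).comap ((absGaloisRestrict K (v.adicCompletion K) :
          absoluteGaloisGroup (v.adicCompletion K) →ₜ* absoluteGaloisGroup K) :
          absoluteGaloisGroup (v.adicCompletion K) →* absoluteGaloisGroup K), σ • R - R ∈ V.localKernelOfReduction v) →
      ∃ S : localPoints V (v.adicCompletion K),
        (∀ σ ∈ (κ.layerSubgroup n).comap ((absGaloisRestrict K (v.adicCompletion K) :
          absoluteGaloisGroup (v.adicCompletion K) →ₜ* absoluteGaloisGroup K) :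
          absoluteGaloisGroup (v.adicCompletion K) →* absoluteGaloisGroup K), σ • S - S ∈ V.localKernelOfReduction v) ∧
        p ^ k • S - p ^ a • R ∈ V.localKernelOfReduction v) :
    ∃ y : geomTorsion V ((p : ℤ) ^ k),
      ∀ h : (κ.layerSubgroup n).comap ((absGaloisRestrict K (v.adicCompletion K) :
          absoluteGaloisGroup (v.adicCompletion K) →ₜ* absoluteGaloisGroup K) :
          absoluteGaloisGroup (v.adicCompletion K) →* absoluteGaloisGroup K),
      V.torsionGaloisModule ((p : ℤ) ^ k) g
          ((((p ^ a : ℕ) : ℤ) • z).1 (subgroupConj (κ.layerSubgroup n) g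
            (comapRestrict (κ.layerSubgroup n) (absGaloisRestrict K (v.adicCompletion K)) h))) -
        (V.torsionGaloisModule ((p : ℤ) ^ k) (absGaloisRestrict K (v.adicCompletion K) (h : absoluteGaloisGroup (v.adicCompletion K))) y - y) ∈
      V.torsionFilAt v ((p : ℤ) ^ k) := by
  -- the Selmer condition for the conjugate class at `v`: a Kummer point `P ∈ E(K̄_v)`
  have hsel : D.proj n s k ∈ V.selmerTorsionOver (κ.layerSubgroup n) ((p : ℤ) ^ k) :=
    ((mem_compactSelmerOver_iff (W := V) (H := κ.layerSubgroup n) p (D.proj n s)).1 (D.proj_mem n s)).1 k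
  have hz' : oneCocycleClass (discreteTopRep (κ.layerSubgroup n) (geomTorsion V ((p : ℤ) ^ k))) z = D.proj n s k := hz
  have hloc := V.localResTorsionOverOfEmb_conjH1_eq_zero_of_mem_selmerTorsionOver hsel v g
  rw [← hz', conjH1_oneCocycleClass] at hloc
  obtain ⟨P, hP⟩ := (CocycleCriteria.resH1Hom_oneCocycleClass_eq_zero_iff _ _ _
    (conjCocycle (κ.layerSubgroup n) g z)).1 hloc
  have hT : ∀ h : (κ.layerSubgroup n).comap ((absGaloisRestrict K (v.adicCompletion K) :
      absoluteGaloisGroup (v.adicCompletion K) →ₜ* absoluteGaloisGroup K) :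
      absoluteGaloisGroup (v.adicCompletion K) →* absoluteGaloisGroup K),
      pointsMapOfEmb V (closureEmb (K := K) (v.adicCompletion K))
        ((g • z.1 (subgroupConj (κ.layerSubgroup n) g
          (comapRestrict (κ.layerSubgroup n) (absGaloisRestrict K (v.adicCompletion K)) h)) :
            geomTorsion V ((p : ℤ) ^ k)) : geomPoints V) =
        (h : absoluteGaloisGroup (v.adicCompletion K)) • P - P := fun h ↦ hP ⟨h, h.2⟩
  -- `p^k P` is fixed by `H_v = Γ_{K_v} ∩ Γ_n`
  have hP₀ : ∀ σ ∈ (κ.layerSubgroup n).comap ((absGaloisRestrict K (v.adicCompletion K) :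
      absoluteGaloisGroup (v.adicCompletion K) →ₜ* absoluteGaloisGroup K) :
      absoluteGaloisGroup (v.adicCompletion K) →* absoluteGaloisGroup K), σ • (p ^ k • P) = p ^ k • P := by
    intro σ hσ
    have h1 := hT ⟨σ, hσ⟩
    have hm0 : ((p : ℤ) ^ k) • ((g • z.1 (subgroupConj (κ.layerSubgroup n) g
        (comapRestrict (κ.layerSubgroup n) (absGaloisRestrict K (v.adicCompletion K)) ⟨σ, hσ⟩)) :
          geomTorsion V ((p : ℤ) ^ k)) : geomPoints V) = 0 :=
      (mem_geomTorsion_iff _ _ _).mp (g • z.1 _).2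
    have h2 : ((p : ℤ) ^ k) • ((σ : absoluteGaloisGroup (v.adicCompletion K)) • P - P) = 0 := by
      rw [← h1, ← map_zsmul, hm0, map_zero]
    rw [smul_sub, sub_eq_zero, smul_comm, ← Nat.cast_pow, natCast_zsmul] at h2
    exact h2
  -- the torsion-coboundary congruence
  obtain ⟨y', hy'k, hy'⟩ := V.exists_torsion_sub_coboundary_mem_localKernelOfReduction v _ k a hdiv₁ hdivH P hP₀
  -- the torsion point `y'` is algebraic
  obtain ⟨y₀, hy₀k, hy₀⟩ := exists_pointsMapOfEmb_eq_of_nsmul_eq_zero V (closureEmb (K := K) (v.adicCompletion K))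
    (pow_ne_zero k hp.out.ne_zero) hy'k
  have hy₀mem : y₀ ∈ geomTorsion V ((p : ℤ) ^ k) := by
    rw [mem_geomTorsion_iff, ← Nat.cast_pow, natCast_zsmul]; exact hy₀k
  refine ⟨⟨y₀, hy₀mem⟩, fun h ↦ ?_⟩
  rw [mem_torsionFilAt_iff]
  -- compute the image in `E(K̄_v)`
  have hval : pointsMapOfEmb V (closureEmb (K := K) (v.adicCompletion K))
      ((V.torsionGaloisModule ((p : ℤ) ^ k) g
          ((((p ^ a : ℕ) : ℤ) • z).1 (subgroupConj (κ.layerSubgroup n) g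
            (comapRestrict (κ.layerSubgroup n) (absGaloisRestrict K (v.adicCompletion K)) h))) -
        (V.torsionGaloisModule ((p : ℤ) ^ k) (absGaloisRestrict K (v.adicCompletion K)
          (h : absoluteGaloisGroup (v.adicCompletion K))) (⟨y₀, hy₀mem⟩ : geomTorsion V ((p : ℤ) ^ k)) -
          (⟨y₀, hy₀mem⟩ : geomTorsion V ((p : ℤ) ^ k))) : geomTorsion V ((p : ℤ) ^ k)) : geomPoints V) =
      ((h : absoluteGaloisGroup (v.adicCompletion K)) • (p ^ a • P) - p ^ a • P) -
        ((h : absoluteGaloisGroup (v.adicCompletion K)) • y' - y') := by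
    have hcz : (((p ^ a : ℕ) : ℤ) • z).1 (subgroupConj (κ.layerSubgroup n) g
        (comapRestrict (κ.layerSubgroup n) (absGaloisRestrict K (v.adicCompletion K)) h)) =
        ((p ^ a : ℕ) : ℤ) • z.1 (subgroupConj (κ.layerSubgroup n) g
          (comapRestrict (κ.layerSubgroup n) (absGaloisRestrict K (v.adicCompletion K)) h)) := rfl
    have hsm : pointsMapOfEmb V (closureEmb (K := K) (v.adicCompletion K))
        (absGaloisRestrict K (v.adicCompletion K) (h : absoluteGaloisGroup (v.adicCompletion K)) • y₀) =
        (h : absoluteGaloisGroup (v.adicCompletion K)) • pointsMapOfEmb V (closureEmb (K := K) (v.adicCompletion K)) y₀ :=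
      pointsMapOfEmb_smul V (closureEmb (K := K) (v.adicCompletion K)) (h : absoluteGaloisGroup (v.adicCompletion K)) y₀
    rw [hcz, map_zsmul, torsionGaloisModule_apply_apply, torsionGaloisModule_apply_apply, AddSubgroupClass.coe_sub,
      AddSubgroupClass.coe_sub, AddSubgroupClass.coe_zsmul, map_sub, map_sub, map_zsmul, hT h,
      AddSubgroup.torsionBy.coe_smul]
    change _ - (pointsMapOfEmb V (closureEmb (K := K) (v.adicCompletion K))
        (absGaloisRestrict K (v.adicCompletion K) (h : absoluteGaloisGroup (v.adicCompletion K)) • y₀) -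
      pointsMapOfEmb V (closureEmb (K := K) (v.adicCompletion K)) y₀) = _
    rw [hsm, hy₀, Nat.cast_pow, ← Nat.cast_pow, natCast_zsmul, smul_sub, smul_comm]
  rw [hval]
  exact hy' _ h.2

section Linear

variable (t : ∀ k, (V.torsionGaloisModule ((p : ℤ) ^ (k + 1))).toContRepresentation →ⁱL
    (V.torsionGaloisModule ((p : ℤ) ^ k)).toContRepresentation)
  (ht : ∀ k (P : geomTorsion V ((p : ℤ) ^ (k + 1))), t k P = V.geomTorsionReduce p k P)
  (I : ZpExtension.EisensteinH1Data (κ.unitTwist (-1)) (fun k ↦ V.torsionGaloisModule ((p : ℤ) ^ k)) t hm)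

include ht

/-- **Clause `(p)` at a place `v ∣ p` of good ordinary reduction, for `h = f s`.** Let `v ∣ p` be a place of good ordinary
reduction (`p ∤ a_v`) at which the residue degrees of the layers of `κ` are bounded (`hres`: some `N₀ ≥ 1` with
`σ^{N₀} ∈ H_{v,n} · I_{K_v}` for every `n` and every `σ ∈ Γ_{K_v}`, `H_{v,n} = Γ_{K_v} ∩ Γ_n`). Then there is `a` (the number of
`E₁(K̄_v)`-cosets of `E(K̄_v)` whose reduction lies in `Ẽ(𝔽_{q_v^{N₀}})`) such that for every `k`,
`p^a • loc_v (proj k (f s))` lies in the strict ordinary core `ker (H¹(K_v, W_k) → H¹(K_v, W_k / Fil_v W_k))`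
(`(V.ordinaryFiltrationAt v t ht).ordinaryCore hm k`) — the hypothesis `hordp` of `EisensteinH1Data.mem_ordinarySelmer_of_local`
at `v`. (Greenberg, LNM 1716, §2, Props. 2.2 and 2.4: the Kummer image at `v ∣ p` is compared with the ordinary condition through
`Ẽ(k_v)(p)`, finite; here uniformly along the tower.) [cite: GreenbergLNM1716, §2 Props. 2.2 and 2.4 (pp. 70–73)]
[cite: Howard2004HeegnerKolyvagin, §2.2 Lemma 2.2.7, Prop. 2.2.8 and §3.1 (H¹_ord), Def. 3.2.6] -/
theorem nsmul_localization_proj_toEisensteinH1Linear_mem_ordinaryCore (hγ : κ.IsTopGenerator γ)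
    (hE : ∀ P : V.toAffine.Point, p • P = 0 → P = 0) (s : D.S) {v : HeightOneSpectrum (𝓞 K)}
    (hpv : (p : 𝓞 K) ∈ v.asIdeal) (hgood : V.HasGoodReductionAt v) (hord : ¬ ((p : ℤ) ∣ V.frobeniusTraceAt v))
    (hres : ∃ N₀ : ℕ, 0 < N₀ ∧ ∀ (n : ℕ) (σ : absoluteGaloisGroup (v.adicCompletion K)),
      ∃ τ ∈ absInertia (v.adicCompletion K), σ ^ N₀ * τ ∈ (κ.layerSubgroup n).comap
        ((absGaloisRestrict K (v.adicCompletion K) : absoluteGaloisGroup (v.adicCompletion K) →ₜ* absoluteGaloisGroup K) :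
          absoluteGaloisGroup (v.adicCompletion K) →* absoluteGaloisGroup K)) :
    ∃ a : ℕ, ∀ k,
      p ^ a • galoisCohomology.localization
          ((κ.unitTwist (-1)).eisensteinTwist (V.torsionGaloisModule ((p : ℤ) ^ k)) hm k) (Sum.inr v) 1
          (I.proj k (D.toEisensteinH1Linear hm t ht I hγ hE s)) ∈
        (V.ordinaryFiltrationAt v t ht).ordinaryCore hm k := by
  -- uniform data at `v`: an arithmetic Frobenius and the finitely many `E₁`-cosets it fixes at depth `N₀`
  obtain ⟨𝔐, h𝔐⟩ := v.localPrimesAbove_nonempty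
  obtain ⟨σ₀, hσ₀⟩ := IsDedekindDomain.HeightOneSpectrum.exists_isArithFrobAt_localAbsIntegers v h𝔐
  obtain ⟨N₀, hN₀, hres⟩ := hres
  obtain ⟨T, hT⟩ := V.exists_finset_sub_mem_localKernelOfReduction_of_isArithFrobAt_pow hgood h𝔐 hσ₀ hN₀
  refine ⟨T.card, fun k ↦ ?_⟩
  haveI := κ.fintypeQuotientLayer (eisensteinLevel (p := p) hm k)
  rw [D.proj_toEisensteinH1Linear hm t ht I hγ hE s k le_rfl, D.eisensteinComponent_apply hm k _ le_rfl s]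
  obtain ⟨z, hz⟩ := oneCocycleClass_surjective
    (subgroupRep (V.torsionGaloisModule ((p : ℤ) ^ k)).toTopRep (κ.layerSubgroup (eisensteinLevel (p := p) hm k)))
    (D.proj (eisensteinLevel (p := p) hm k) s k)
  have hcl : (κ.unitTwist (-1)).coresEisenstein (V.torsionGaloisModule ((p : ℤ) ^ k)) hm k
        (κ.layerSubgroup (eisensteinLevel (p := p) hm k)) (layerSubgroup_le_unitTwist_layerSubgroup hm le_rfl)
        (κ.isOpen_layerSubgroup _) (oneCocycleClass _ (((p ^ T.card : ℕ) : ℤ) • z)) =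
      p ^ T.card • (κ.unitTwist (-1)).coresEisenstein (V.torsionGaloisModule ((p : ℤ) ^ k)) hm k
        (κ.layerSubgroup (eisensteinLevel (p := p) hm k)) (layerSubgroup_le_unitTwist_layerSubgroup hm le_rfl)
        (κ.isOpen_layerSubgroup _) (D.proj (eisensteinLevel (p := p) hm k) s k) := by
    rw [oneCocycleClass_smul, Nat.cast_smul_eq_nsmul, map_nsmul, hz]
  rw [← map_nsmul, ← hcl]
  refine (κ.unitTwist (-1)).localization_coresEisenstein_mem_ordinaryCore (fun j ↦ V.torsionGaloisModule ((p : ℤ) ^ j))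
    t hm k (κ.layerSubgroup _) (layerSubgroup_le_unitTwist_layerSubgroup hm le_rfl) (κ.isOpen_layerSubgroup _)
    (V.ordinaryFiltrationAt v t ht) _ fun g ↦ ?_
  -- the cocycle hypothesis, from the arithmetic at `v`
  refine D.proj_conj_cocycle_sub_coboundary_mem_torsionFilAt _ k T.card s g z hz
    (fun Q hQ ↦ V.exists_pow_nsmul_eq_of_mem_localKernelOfReduction_of_ordinary hpv hgood hord k hQ)
    (fun R hR ↦ ?_)
  -- `p^{#T} (E/E₁)^{H_v} ⊆ p^k (E/E₁)^{H_v}` for `H_v = Γ_{K_v} ∩ Γ_n`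
  let Q : AddSubgroup (localPoints V (v.adicCompletion K)) :=
    { carrier := {R' | ∀ σ ∈ (κ.layerSubgroup (eisensteinLevel (p := p) hm k)).comap
          ((absGaloisRestrict K (v.adicCompletion K) : absoluteGaloisGroup (v.adicCompletion K) →ₜ* absoluteGaloisGroup K) :
            absoluteGaloisGroup (v.adicCompletion K) →* absoluteGaloisGroup K),
        σ • R' - R' ∈ V.localKernelOfReduction v}
      add_mem' := fun {a b} ha hb σ hσ ↦ by
        simp only [Set.mem_setOf_eq] at ha hb ⊢
        rw [smul_add, add_sub_add_comm]
        exact add_mem (ha σ hσ) (hb σ hσ)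
      zero_mem' := fun σ _ ↦ by rw [smul_zero, sub_zero]; exact zero_mem _
      neg_mem' := fun {a} ha σ hσ ↦ by
        simp only [Set.mem_setOf_eq] at ha ⊢
        rw [smul_neg, neg_sub_neg, ← neg_sub]
        exact neg_mem (ha σ hσ) }
  have hQ : ∀ R' ∈ Q, ∃ t' ∈ T, R' - t' ∈ V.localKernelOfReduction v := by
    intro R' hR'
    obtain ⟨τ, hτ, hτ₀⟩ := hres (eisensteinLevel (p := p) hm k) σ₀
    exact hT R' (V.smul_sub_mem_localKernelOfReduction_of_mul_mem hgood hτ hτ₀ R' hR')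
  obtain ⟨S, hS, hSR⟩ := AddSubgroup.exists_nsmul_sub_mem_of_finset (V.localKernelOfReduction v) Q T hQ hp.out k
    (R := R) hR
  exact ⟨S, hS, hSR⟩

/-- **`f(𝔖_p(K_∞)) ⊆ H¹_{F_𝔮}(K, T_𝔮)`** (Howard, Lemma 2.2.7 / Prop. 2.2.8: "the image of `𝔖 → H¹(K, T_𝔮)` lies in the
Selmer group of `F_𝔮`"), for the pinned `ordinarySelmer` of `EisensteinH1Data`: for every `s ∈ 𝔖` and every finite set `S` of
finite places containing the bad places, `f s ∈ H¹_{F_𝔮}(K, T_𝔮)` — the three clauses of `mem_ordinarySelmer_of_local` are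
`toEisensteinH1Linear_hur` (`(ur)`, `LambdaAdicSelmerDataUnramified`), `toEisensteinH1Linear_hS_of_kodairaNeron` (`(S)`,
`LambdaAdicSelmerDataSaturatedKodairaNeronProofs`) and `nsmul_localization_proj_toEisensteinH1Linear_mem_ordinaryCore`
(`(p)`, this file) — provided every `v ∣ p` is a place of good ordinary reduction with bounded residue degrees in `κ`, and
`E(K)[p] = 0`, `γ` a topological generator (the standing hypotheses of `toEisensteinH1Linear`).
[cite: Howard2004HeegnerKolyvagin, §2.2 Lemma 2.2.7 and Prop. 2.2.8; Def. 3.1.2] [cite: GreenbergLNM1716, §2 Props. 2.1–2.4]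
[cite: MazurRubinMemoirs2004, Lemma 5.3.13] -/
theorem toEisensteinH1Linear_mem_ordinarySelmer (hγ : κ.IsTopGenerator γ) (hE : ∀ P : V.toAffine.Point, p • P = 0 → P = 0)
    (S : Finset (HeightOneSpectrum (𝓞 K))) (hS : ∀ v ∈ V.badPlaces (𝓞 K), v ∈ S) (s : D.S)
    (hgood : ∀ v : HeightOneSpectrum (𝓞 K), (p : 𝓞 K) ∈ v.asIdeal → V.HasGoodReductionAt v)
    (hord : ∀ v : HeightOneSpectrum (𝓞 K), (p : 𝓞 K) ∈ v.asIdeal → ¬ ((p : ℤ) ∣ V.frobeniusTraceAt v))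
    (hres : ∀ v : HeightOneSpectrum (𝓞 K), (p : 𝓞 K) ∈ v.asIdeal → ∃ N₀ : ℕ, 0 < N₀ ∧
      ∀ (n : ℕ) (σ : absoluteGaloisGroup (v.adicCompletion K)), ∃ τ ∈ absInertia (v.adicCompletion K),
        σ ^ N₀ * τ ∈ (κ.layerSubgroup n).comap ((absGaloisRestrict K (v.adicCompletion K) :
          absoluteGaloisGroup (v.adicCompletion K) →ₜ* absoluteGaloisGroup K) :
            absoluteGaloisGroup (v.adicCompletion K) →* absoluteGaloisGroup K)) :
    D.toEisensteinH1Linear hm t ht I hγ hE s ∈ I.ordinarySelmer S (fun v _ ↦ V.ordinaryFiltrationAt v t ht) :=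
  I.mem_ordinarySelmer_of_local S (fun v _ ↦ V.ordinaryFiltrationAt v t ht) _
    (fun v hv ↦ D.nsmul_localization_proj_toEisensteinH1Linear_mem_ordinaryCore hm t ht I hγ hE s hv (hgood v hv)
      (hord v hv) (hres v hv))
    (D.toEisensteinH1Linear_hS_of_kodairaNeron hm t ht I hγ hE S s) (D.toEisensteinH1Linear_hur hm t ht I hγ hE S hS s)

/-- **`f(𝔖_p(K_∞)) ⊆ H_m`** — the same containment for the `Λ`-submodule form `EisensteinH1Data.selmerSubmodule` of
`H¹_{F_𝔮}(K, T_𝔮)` (any stability witness `h𝓕`, e.g. `ZpExtension.map_eisensteinTwistSMulHom_mem_selmerGroup` of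
`ZpExtensionEisensteinSelmerStructureProofs`): the target `H_m` of the control map in Howard's Prop. 2.2.8.
[cite: Howard2004HeegnerKolyvagin, §2.2 Prop. 2.2.8 and Def. 2.2.3] -/
theorem toEisensteinH1Linear_mem_selmerSubmodule (hγ : κ.IsTopGenerator γ) (hE : ∀ P : V.toAffine.Point, p • P = 0 → P = 0)
    (S : Finset (HeightOneSpectrum (𝓞 K))) (hS : ∀ v ∈ V.badPlaces (𝓞 K), v ∈ S) (s : D.S)
    (hgood : ∀ v : HeightOneSpectrum (𝓞 K), (p : 𝓞 K) ∈ v.asIdeal → V.HasGoodReductionAt v)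
    (hord : ∀ v : HeightOneSpectrum (𝓞 K), (p : 𝓞 K) ∈ v.asIdeal → ¬ ((p : ℤ) ∣ V.frobeniusTraceAt v))
    (hres : ∀ v : HeightOneSpectrum (𝓞 K), (p : 𝓞 K) ∈ v.asIdeal → ∃ N₀ : ℕ, 0 < N₀ ∧
      ∀ (n : ℕ) (σ : absoluteGaloisGroup (v.adicCompletion K)), ∃ τ ∈ absInertia (v.adicCompletion K),
        σ ^ N₀ * τ ∈ (κ.layerSubgroup n).comap ((absGaloisRestrict K (v.adicCompletion K) :
          absoluteGaloisGroup (v.adicCompletion K) →ₜ* absoluteGaloisGroup K) :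
            absoluteGaloisGroup (v.adicCompletion K) →* absoluteGaloisGroup K))
    (h𝓕 : ∀ (k : ℕ) (c : IwasawaAlgebra.EisensteinCoeff p m k)
      (x : galoisCohomology ((κ.unitTwist (-1)).eisensteinTwist (V.torsionGaloisModule ((p : ℤ) ^ k)) hm k) 1),
      x ∈ ((κ.unitTwist (-1)).eisensteinSelmerStructure (fun k ↦ V.torsionGaloisModule ((p : ℤ) ^ k)) t hm S
          (fun v _ ↦ V.ordinaryFiltrationAt v t ht) k).selmerGroup →
        galoisCohomology.map ((κ.unitTwist (-1)).eisensteinTwistSMulHom (V.torsionGaloisModule ((p : ℤ) ^ k)) hm k c) 1 x ∈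
          ((κ.unitTwist (-1)).eisensteinSelmerStructure (fun k ↦ V.torsionGaloisModule ((p : ℤ) ^ k)) t hm S
            (fun v _ ↦ V.ordinaryFiltrationAt v t ht) k).selmerGroup) :
    D.toEisensteinH1Linear hm t ht I hγ hE s ∈
      I.selmerSubmodule ((κ.unitTwist (-1)).eisensteinSelmerStructure (fun k ↦ V.torsionGaloisModule ((p : ℤ) ^ k)) t hm S
        (fun v _ ↦ V.ordinaryFiltrationAt v t ht)) h𝓕 :=
  D.toEisensteinH1Linear_mem_ordinarySelmer hm t ht I hγ hE S hS s hgood hord hres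

end Linear

end WeierstrassCurve.LambdaAdicSelmerData

end
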